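import Summits.QuantumFields.YangMills.Theorems.FluctuationComparisonRegPrIntLWregGlue
import HarnessLib

/-!
# S2β · LAPLACE stub — the (T)-EXISTENCE KNIT: the semiclassical 4-point limit from per-datum scaled Laplace limits,
# the coupling scaling `β_K(γ∕λ) = λ·β_K(γ)`, and the Laplace-integral form of `heightDensityCan(γ∕λ)·e^{λβ_K m}` on a window chart

Cell `ym3-torus` (rung R3: continuum `SU(2)` Yang–Mills on `T³` — NOT `d = 4`, NOT infinite volume, NOT a mass gap, NOT Clay); width seat
`ym-ust-20520-w4` g15; helper of the crux `stmt-QuantumFields-20520` `UnitScaleTilt.FluctuationComparisonRegPrIntL` (`--supports`, NOT a proof of it).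

CONTEXT.  LINE g18-1 `Cruxes/FluctuationComparisonRegPrIntL/Lines/semiclassical_s2beta.lean` (ideator seat ym-r3-idea-1) isolates S2β's one-loop row as
`stub_oneLoopLaplace : WindowExactness → UniformFibreGap → WindowRegularity → OneLoopClusteredCan`.  Its clause (T) asks, at every window quadrilateral
`U V W Z` (corners differing on two bonds), that the mixed second difference («4-point», `fourPt f U V W Z = (f U − f V) − (f W − f Z)`) of the λ-scaled
fluctuation part `f^λ(x) = log heightDensityCan F (γ∕λ) hJK S x + β_K(γ∕λ)·m(x)` (`m = minActionRegPr`, `S = histGood`) CONVERGE as `λ → ∞`, with a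
clustered limit.  Laplace's method delivers, datum by datum, limits of the shape `λ^c · e^{f^λ(x)} → C(x) > 0` with ONE exponent `c = (transversal
dimension)∕2` for all data (the tree's library `Literature/Analysis/Asymptotics/LaplaceMethod{Multivariate,MorseBottFibred,Chart,CompactGroup,Orbit,
OrbitCompact,…}`).  This file is the bookkeeping between the two formats:

* §1 (pure real analysis, any index type `X`) `eventually_pos_of_tendsto_rpow_mul`, `tendsto_log_of_tendsto_rpow_mul`,
  ★`tendsto_sub_log_of_tendsto_rpow_mul` (2-point), ★`tendsto_fourPt_log_of_tendsto_rpow_mul` (4-point): the `c·log λ` CANCELS in differences, so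
  per-corner scaled limits give the limit of the 4-point of `log G_λ` — the card's «datum-independence of the `−(n∕2)·log λ` term» as a lemma;
  `tendsto_rpow_mul_comp_mul_atTop` (reparametrising the large parameter `β' = λ·β_K`).
* §2 `scheme_β_div` — `(F.scheme ℰp (γ∕λ)).β K = λ · (F.scheme ℰp γ).β K` ([Balaban1985UV3] (1): `β_K = (γ ε_K)⁻¹`), `boltzmann_scheme_β_div`.
* §3 `heightDensityCan_mul_exp_eq_integral` — on a WREG window chart `c : WindowChart F hJK S O` (✓F3 `…WregGlue.heightDensityCan_eq_fibreInt`), for `V ∈ O`,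
  `λ > 0`: `heightDensityCan F (γ∕λ) hJK S V · e^{λ β_K m} = ∫ z, jac(V,z) · 1_S(Φ(V,z)) · e^{−(λβ_K)(A(Φ(V,z)) − m)} dν_K` — `e^{f^λ(V)}` IS a Laplace integral in
  the library's input format (phase `A ∘ Φ(V,·)`, floor `m`, amplitude `jac · 1_S ∘ Φ`, large parameter `λβ_K`).
* §4 ★★`tendsto_fourPt_fluct_of_laplaceLimits` — THE DOOR in the line's letters: per-corner limits
  `λ^c · (heightDensityCan F (γ∕λ) hJK S x · e^{λ β_K m x}) → C x > 0` (`x ∈ {U,V,W,Z}`) ⟹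
  `Tendsto (λ ↦ fourPt (x ↦ log heightDensityCan F (γ∕λ) hJK S x + (F.scheme ℰp (γ∕λ)).β K · m x) U V W Z) atTop (𝓝 (fourPt (log ∘ C) U V W Z))`,
  which is (T)'s `Tendsto` conjunct after `unfold fourPt fluctAtCan` (and identifies `oneLoopFourPtCan = fourPt (log ∘ C)` by the line's
  `oneLoopFourPtCan_eq_of_tendsto`).  So (T) = LAPLACE-LIMIT (per datum; the library + the organs) ∘ KNIT (here) ∘ DECAY (`|fourPt (log∘C)| ≤ φ₁ e^{−κ d}`).

HONEST SCOPE.  Bookkeeping only (real analysis on `ℝ` + one integral identity); the per-datum Laplace limits, the DECAY bound, EXW ∕ GAP ∕ WREG ∕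
LAPLACE ∕ H4ᶜ ∕ LFR♯ᶜ, S2β, the run-pair package and the crux 20520 are NOT proved here; `YM3TorusSU2` NOT proved; the Yang–Mills mass gap (Clay) NOT
proved.  Def-free; no `instance` ∕ `notation`; default heartbeats.

References: [Balaban1985UV3] T. Bałaban, CMP 102 (1985), (1)–(2) p. 256, (41) p. 266; [Balaban1985Variational] CMP 102 (1985) Thm 1 (8)–(10) p. 279;
[Breitung1994] K. W. Breitung, LNM 1592, Thm 41 p. 56 (Laplace's method, leading order).
-/

noncomputable section

open MeasureTheory Filter Topology Set
open scoped ENNReal NNReal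
open Literature.MathematicalPhysics.QuantumFieldTheory.Balaban1983to89
open Literature.MathematicalPhysics.QuantumFieldTheory.Balaban1983to89.T3ContinuumYM3Torus
open Literature.MathematicalPhysics.QuantumFieldTheory.Balaban1983to89.T3UnitLawDensityEML
open Literature.MathematicalPhysics.QuantumFieldTheory.Balaban1983to89.T3UnitScaleTilt
open Literature.MathematicalPhysics.QuantumFieldTheory.Balaban1983to89.T3TiltDescent
open Literature.MathematicalPhysics.QuantumFieldTheory.Balaban1983to89.Missing
open Literature.MathematicalPhysics.QuantumFieldTheory.Balaban1983to89.T4Continuum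
open Summit.QuantumFields.YangMills.Theorems.FluctuationComparisonRegPrIntLWregGlue

namespace Summit.QuantumFields.YangMills.Theorems.FluctuationComparisonRegPrIntLS2BetaLaplaceKnit

/-! ## §1 The knit on `ℝ`: scaled limits `λ^c · G_λ(x) → C(x) > 0` ⟹ limits of differences of `log G_λ` (the `c·log λ` cancels) -/

section Knit

variable {X : Type*}

/-- `log (λ^c · g) = c·log λ + log g` for `λ > 0`, `g ≠ 0`. [cite: Breitung1994, Thm 41 p. 56 (bookkeeping)] -/
theorem log_rpow_mul {lam : ℝ} (hlam : 0 < lam) (c : ℝ) {g : ℝ} (hg : g ≠ 0) :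
    Real.log (lam ^ c * g) = c * Real.log lam + Real.log g := by
  rw [Real.log_mul (Real.rpow_pos_of_pos hlam c).ne' hg, Real.log_rpow hlam]

/-- If `λ^c · G λ → C > 0` then eventually `0 < G λ`. [cite: Breitung1994, Thm 41 p. 56 (bookkeeping)] -/
theorem eventually_pos_of_tendsto_rpow_mul {G : ℝ → ℝ} {c C : ℝ}
    (h : Tendsto (fun lam : ℝ => lam ^ c * G lam) atTop (𝓝 C)) (hC : 0 < C) : ∀ᶠ lam : ℝ in atTop, 0 < G lam := by
  filter_upwards [h.eventually (lt_mem_nhds hC), eventually_gt_atTop (0 : ℝ)] with lam hlam hlam0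
  exact pos_of_mul_pos_right hlam (Real.rpow_pos_of_pos hlam0 c).le

/-- If `λ^c · G λ → C > 0` then `c·log λ + log (G λ) → log C`. [cite: Breitung1994, Thm 41 p. 56 (bookkeeping)] -/
theorem tendsto_log_of_tendsto_rpow_mul {G : ℝ → ℝ} {c C : ℝ}
    (h : Tendsto (fun lam : ℝ => lam ^ c * G lam) atTop (𝓝 C)) (hC : 0 < C) :
    Tendsto (fun lam : ℝ => c * Real.log lam + Real.log (G lam)) atTop (𝓝 (Real.log C)) := by
  have hlog : Tendsto (fun lam : ℝ => Real.log (lam ^ c * G lam)) atTop (𝓝 (Real.log C)) :=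
    (Real.continuousAt_log hC.ne').tendsto.comp h
  refine hlog.congr' ?_
  filter_upwards [eventually_pos_of_tendsto_rpow_mul h hC, eventually_gt_atTop (0 : ℝ)] with lam hG hlam
  exact log_rpow_mul hlam c hG.ne'

/-- ★ **2-POINT KNIT**: with ONE exponent `c` at both data, `λ^c · G_λ(U) → C U > 0` and `λ^c · G_λ(V) → C V > 0` give
`log G_λ(U) − log G_λ(V) → log C U − log C V` — the `c·log λ` cancels. [cite: Breitung1994, Thm 41 p. 56 (bookkeeping)] -/
theorem tendsto_sub_log_of_tendsto_rpow_mul {G : ℝ → X → ℝ} {c : ℝ} {C : X → ℝ} {U V : X}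
    (hU : Tendsto (fun lam : ℝ => lam ^ c * G lam U) atTop (𝓝 (C U))) (hV : Tendsto (fun lam : ℝ => lam ^ c * G lam V) atTop (𝓝 (C V)))
    (hCU : 0 < C U) (hCV : 0 < C V) :
    Tendsto (fun lam : ℝ => Real.log (G lam U) - Real.log (G lam V)) atTop (𝓝 (Real.log (C U) - Real.log (C V))) := by
  refine ((tendsto_log_of_tendsto_rpow_mul hU hCU).sub (tendsto_log_of_tendsto_rpow_mul hV hCV)).congr' ?_
  exact Eventually.of_forall fun lam => by ring

/-- ★ **4-POINT KNIT** (the LAPLACE stub's (T)-existence bookkeeping): with ONE exponent `c` at the four corners, per-corner scaled limits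
`λ^c · G_λ(x) → C x > 0` give `fourPt (log G_λ) U V W Z → fourPt (log ∘ C) U V W Z` (4-point spelled out). [cite: Breitung1994, Thm 41 p. 56 (bookkeeping)] -/
theorem tendsto_fourPt_log_of_tendsto_rpow_mul {G : ℝ → X → ℝ} {c : ℝ} {C : X → ℝ} {U V W Z : X}
    (hU : Tendsto (fun lam : ℝ => lam ^ c * G lam U) atTop (𝓝 (C U))) (hV : Tendsto (fun lam : ℝ => lam ^ c * G lam V) atTop (𝓝 (C V)))
    (hW : Tendsto (fun lam : ℝ => lam ^ c * G lam W) atTop (𝓝 (C W))) (hZ : Tendsto (fun lam : ℝ => lam ^ c * G lam Z) atTop (𝓝 (C Z)))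
    (hCU : 0 < C U) (hCV : 0 < C V) (hCW : 0 < C W) (hCZ : 0 < C Z) :
    Tendsto (fun lam : ℝ => (Real.log (G lam U) - Real.log (G lam V)) - (Real.log (G lam W) - Real.log (G lam Z))) atTop
      (𝓝 ((Real.log (C U) - Real.log (C V)) - (Real.log (C W) - Real.log (C Z)))) :=
  (tendsto_sub_log_of_tendsto_rpow_mul hU hV hCU hCV).sub (tendsto_sub_log_of_tendsto_rpow_mul hW hZ hCW hCZ)

/-- The exponential form of the 4-point knit: per-corner `λ^c · e^{f_λ(x)} → C x > 0` give `fourPt f_λ U V W Z → fourPt (log ∘ C) U V W Z`.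
[cite: Breitung1994, Thm 41 p. 56 (bookkeeping)] -/
theorem tendsto_fourPt_of_tendsto_rpow_mul_exp {f : ℝ → X → ℝ} {c : ℝ} {C : X → ℝ} {U V W Z : X}
    (hU : Tendsto (fun lam : ℝ => lam ^ c * Real.exp (f lam U)) atTop (𝓝 (C U)))
    (hV : Tendsto (fun lam : ℝ => lam ^ c * Real.exp (f lam V)) atTop (𝓝 (C V)))
    (hW : Tendsto (fun lam : ℝ => lam ^ c * Real.exp (f lam W)) atTop (𝓝 (C W)))
    (hZ : Tendsto (fun lam : ℝ => lam ^ c * Real.exp (f lam Z)) atTop (𝓝 (C Z)))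
    (hCU : 0 < C U) (hCV : 0 < C V) (hCW : 0 < C W) (hCZ : 0 < C Z) :
    Tendsto (fun lam : ℝ => (f lam U - f lam V) - (f lam W - f lam Z)) atTop
      (𝓝 ((Real.log (C U) - Real.log (C V)) - (Real.log (C W) - Real.log (C Z)))) := by
  have h := tendsto_fourPt_log_of_tendsto_rpow_mul (G := fun lam x => Real.exp (f lam x)) hU hV hW hZ hCU hCV hCW hCZ
  simpa only [Real.log_exp] using h

/-- REPARAMETRISING THE LARGE PARAMETER: if `b^c · I b → ℓ` as `b → ∞` then, for `β > 0`, `λ^c · I (λβ) → ℓ ∕ β^c` as `λ → ∞`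
(Laplace's method is run in `β' = λ·β_K`; the line's parameter is `λ`). [cite: Breitung1994, Thm 41 p. 56 (bookkeeping)] -/
theorem tendsto_rpow_mul_comp_mul_atTop {I : ℝ → ℝ} {c ℓ β : ℝ} (hβ : 0 < β)
    (h : Tendsto (fun b : ℝ => b ^ c * I b) atTop (𝓝 ℓ)) :
    Tendsto (fun lam : ℝ => lam ^ c * I (lam * β)) atTop (𝓝 (ℓ / β ^ c)) := by
  have h1 : Tendsto (fun lam : ℝ => lam * β) atTop atTop := tendsto_id.atTop_mul_const hβ
  have h2 : Tendsto (fun lam : ℝ => (β ^ c)⁻¹ * ((lam * β) ^ c * I (lam * β))) atTop (𝓝 ((β ^ c)⁻¹ * ℓ)) :=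
    (h.comp h1).const_mul _
  have hβc : 0 < β ^ c := Real.rpow_pos_of_pos hβ c
  rw [div_eq_inv_mul]
  refine h2.congr' ?_
  filter_upwards [eventually_ge_atTop (0 : ℝ)] with lam hlam
  rw [Real.mul_rpow hlam hβ.le]
  field_simp

end Knit

/-! ## §2 The coupling scaling of the d = 3 Wilson scheme: `β_K(γ∕λ) = λ·β_K(γ)` -/

section Scaling

variable (F : T3Family)

/-- **`β_K(γ∕λ) = λ · β_K(γ)`**: the scheme's inverse coupling is `β_K = (γ ε_K)⁻¹`, so dividing the terminal coupling by `λ` multiplies every `β_K` by `λ`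
(also at `λ = 0`, both sides being `0`). [cite: Balaban1985UV3, (1)-(2) p. 256] -/
theorem scheme_β_div (γ lam : ℝ) (K : ℕ) : (F.scheme ℰp (γ / lam)).β K = lam * (F.scheme ℰp γ).β K := by
  show (γ / lam * (F.P K).eps)⁻¹ = lam * (γ * (F.P K).eps)⁻¹
  rw [div_mul_eq_mul_div, inv_div, div_eq_mul_inv]

/-- The Boltzmann factor at the divided coupling: `e^{−β_K(γ∕λ) A(U)} = e^{−(λβ_K(γ)) A(U)}`. [cite: Balaban1985UV3, (1)-(2) p. 256] -/
theorem boltzmann_scheme_β_div (γ lam : ℝ) (K : ℕ) (U : GaugeField (F.P K) 0 (Matrix.specialUnitaryGroup (Fin 2) ℂ)) :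
    boltzmann (F.P K) ((F.scheme ℰp (γ / lam)).β K) U = Real.exp (-(lam * (F.scheme ℰp γ).β K) * wilsonAction4 U) := by
  rw [boltzmann, scheme_β_div]

end Scaling


/-! ## §3 `e^{f^λ(V)}` is a Laplace integral: the canonical density at coupling `γ∕λ` times `e^{λβ_K m}` on a window chart -/

section LaplaceForm

variable {F : T3Family} {J K : ℕ} {hJK : J ≤ K} {S : Set (GaugeField (F.P K) 0 (Matrix.specialUnitaryGroup (Fin 2) ℂ))}
  {O : Set (GaugeField (F.P J) 0 (Matrix.specialUnitaryGroup (Fin 2) ℂ))}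

/-- **THE LAPLACE-INTEGRAL FORM** (on a window chart, `V ∈ O`, `λ > 0`, any floor `m`):
`heightDensityCan F (γ∕λ) hJK S V · e^{λβ_K m} = ∫ z, jac(V,z) · 1_S(Φ(V,z)) · e^{−(λβ_K)(A(Φ(V,z)) − m)} dν_K` — phase `A ∘ Φ(V,·)` (`A = wilsonAction4`),
floor `m`, amplitude `jac · 1_S ∘ Φ`, large parameter `λβ_K(γ)`; with `m = minActionRegPr V` and `S = histGood` the left side is `e^{fluctAtCan λ V}` of
LINE g18-1 whenever the density is positive. [cite: Balaban1985UV3, (2) p. 256 and (41) p. 266] -/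
theorem heightDensityCan_mul_exp_eq_integral (c : WindowChart F hJK S O) (hO : IsOpen O) (hSm : MeasurableSet S)
    {γ : ℝ} (hγ : 0 ≤ γ) {lam : ℝ} (hlam : 0 < lam) (m : ℝ)
    {V : GaugeField (F.P J) 0 (Matrix.specialUnitaryGroup (Fin 2) ℂ)} (hV : V ∈ O) :
    heightDensityCan F (γ / lam) hJK S V * Real.exp (lam * (F.scheme ℰp γ).β K * m) =
      ∫ z, (c.jac (V, z) : ℝ) * S.indicator (fun _ => (1 : ℝ)) (c.Φ (V, z)) *
        Real.exp (-(lam * (F.scheme ℰp γ).β K) * (wilsonAction4 (c.Φ (V, z)) - m))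
        ∂fieldMeasure (F.P K) 0 (Matrix.specialUnitaryGroup (Fin 2) ℂ) := by
  rw [heightDensityCan_eq_fibreInt c hO hSm (div_nonneg hγ hlam.le) hV, ← integral_mul_const]
  congr 1
  funext z
  by_cases hz : c.Φ (V, z) ∈ S
  · rw [Set.indicator_of_mem hz, Set.indicator_of_mem hz, boltzmann_scheme_β_div, mul_one, mul_assoc, ← Real.exp_add]
    congr 2
    ring
  · simp only [Set.indicator_of_notMem hz, mul_zero, zero_mul]

/-- `0 < β_K(γ)` for `γ > 0`. [cite: Balaban1985UV3, (1)-(2) p. 256] -/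
theorem scheme_β_pos (F : T3Family) {γ : ℝ} (hγ : 0 < γ) (K : ℕ) : 0 < (F.scheme ℰp γ).β K := by
  show 0 < (γ * (F.P K).eps)⁻¹
  exact inv_pos.mpr (mul_pos hγ (F.P K).eps_pos)

/-- **FROM THE LIBRARY'S OUTPUT FORMAT TO THE LINE'S PARAMETER**: if Laplace's method gives, in its own large parameter `b`,
`b^c · ∫ z, jac(V,z) · 1_S(Φ(V,z)) · e^{−b(A(Φ(V,z)) − m)} dν_K → ℓ`, then in the line's parameter `λ` (`b = λβ_K(γ)`, `γ > 0`)
`λ^c · (heightDensityCan F (γ∕λ) hJK S V · e^{λβ_K m}) → ℓ ∕ β_K^c`. [cite: Balaban1985UV3, (2) p. 256 and (41) p. 266] -/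
theorem tendsto_rpow_mul_heightDensityCan_of_laplace (c : WindowChart F hJK S O) (hO : IsOpen O) (hSm : MeasurableSet S)
    {γ : ℝ} (hγ : 0 < γ) (m : ℝ) {V : GaugeField (F.P J) 0 (Matrix.specialUnitaryGroup (Fin 2) ℂ)} (hV : V ∈ O) {cexp ℓ : ℝ}
    (h : Tendsto (fun b : ℝ => b ^ cexp * ∫ z, (c.jac (V, z) : ℝ) * S.indicator (fun _ => (1 : ℝ)) (c.Φ (V, z)) *
        Real.exp (-b * (wilsonAction4 (c.Φ (V, z)) - m)) ∂fieldMeasure (F.P K) 0 (Matrix.specialUnitaryGroup (Fin 2) ℂ)) atTop (𝓝 ℓ)) :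
    Tendsto (fun lam : ℝ => lam ^ cexp * (heightDensityCan F (γ / lam) hJK S V * Real.exp (lam * (F.scheme ℰp γ).β K * m))) atTop
      (𝓝 (ℓ / ((F.scheme ℰp γ).β K) ^ cexp)) := by
  refine (tendsto_rpow_mul_comp_mul_atTop (scheme_β_pos F hγ K) h).congr' ?_
  filter_upwards [eventually_gt_atTop (0 : ℝ)] with lam hlam
  rw [heightDensityCan_mul_exp_eq_integral c hO hSm hγ.le hlam m hV]

end LaplaceForm

/-! ## §4 The door in the line's letters: per-corner scaled Laplace limits ⟹ the (T) `Tendsto` clause of 1L4ᶜ -/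

section Door

variable (F : T3Family) (γ : ℝ) {J K : ℕ} (hJK : J ≤ K) (S : Set (GaugeField (F.P K) 0 (Matrix.specialUnitaryGroup (Fin 2) ℂ)))
  (m : GaugeField (F.P J) 0 (Matrix.specialUnitaryGroup (Fin 2) ℂ) → ℝ)

/-- One corner: `λ^c · (heightDensityCan(γ∕λ) x · e^{λβ_K m x}) → C x > 0` gives `c·log λ + f^λ(x) → log C x`, where
`f^λ(x) = log heightDensityCan F (γ∕λ) hJK S x + (F.scheme ℰp (γ∕λ)).β K · m x` (the density is eventually positive, so `log` splits).
[cite: Balaban1985UV3, (41) p. 266] -/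
theorem tendsto_log_add_fluct_of_laplaceLimit {c : ℝ} {Cx : ℝ} {x : GaugeField (F.P J) 0 (Matrix.specialUnitaryGroup (Fin 2) ℂ)}
    (hx : Tendsto (fun lam : ℝ => lam ^ c * (heightDensityCan F (γ / lam) hJK S x * Real.exp (lam * (F.scheme ℰp γ).β K * m x)))
      atTop (𝓝 Cx)) (hCx : 0 < Cx) :
    Tendsto (fun lam : ℝ => c * Real.log lam +
        (Real.log (heightDensityCan F (γ / lam) hJK S x) + (F.scheme ℰp (γ / lam)).β K * m x)) atTop (𝓝 (Real.log Cx)) := by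
  refine (tendsto_log_of_tendsto_rpow_mul hx hCx).congr' ?_
  filter_upwards [eventually_pos_of_tendsto_rpow_mul hx hCx] with lam hpos
  have hd : 0 < heightDensityCan F (γ / lam) hJK S x := pos_of_mul_pos_left hpos (Real.exp_pos _).le
  rw [Real.log_mul hd.ne' (Real.exp_pos _).ne', Real.log_exp, scheme_β_div]

/-- ★★ **THE (T)-EXISTENCE DOOR**: per-corner scaled Laplace limits with ONE exponent `c`,
`λ^c · (heightDensityCan F (γ∕λ) hJK S x · e^{λβ_K(γ) m x}) → C x > 0` for `x ∈ {U, V, W, Z}`, give the convergence of the 4-point of the λ-scaled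
fluctuation part `f^λ = log heightDensityCan F (γ∕λ) hJK S · + (F.scheme ℰp (γ∕λ)).β K · m ·` to `fourPt (log ∘ C) U V W Z` — with `S = histGood`,
`m = minActionRegPr F J K hJK ε₀` this is the `Tendsto` conjunct of 1L4ᶜ (T) after `unfold fourPt fluctAtCan`, and it identifies the line's
`oneLoopFourPtCan U V W Z` with `(log C U − log C V) − (log C W − log C Z)`. [cite: Balaban1985Variational, Thm 1 (8)-(10) p. 279]
[cite: Balaban1985UV3, (41) p. 266] -/
theorem tendsto_fourPt_fluct_of_laplaceLimits {c : ℝ} {C : GaugeField (F.P J) 0 (Matrix.specialUnitaryGroup (Fin 2) ℂ) → ℝ}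
    {U V W Z : GaugeField (F.P J) 0 (Matrix.specialUnitaryGroup (Fin 2) ℂ)}
    (hU : Tendsto (fun lam : ℝ => lam ^ c * (heightDensityCan F (γ / lam) hJK S U * Real.exp (lam * (F.scheme ℰp γ).β K * m U))) atTop (𝓝 (C U)))
    (hV : Tendsto (fun lam : ℝ => lam ^ c * (heightDensityCan F (γ / lam) hJK S V * Real.exp (lam * (F.scheme ℰp γ).β K * m V))) atTop (𝓝 (C V)))
    (hW : Tendsto (fun lam : ℝ => lam ^ c * (heightDensityCan F (γ / lam) hJK S W * Real.exp (lam * (F.scheme ℰp γ).β K * m W))) atTop (𝓝 (C W)))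
    (hZ : Tendsto (fun lam : ℝ => lam ^ c * (heightDensityCan F (γ / lam) hJK S Z * Real.exp (lam * (F.scheme ℰp γ).β K * m Z))) atTop (𝓝 (C Z)))
    (hCU : 0 < C U) (hCV : 0 < C V) (hCW : 0 < C W) (hCZ : 0 < C Z) :
    Tendsto (fun lam : ℝ =>
      ((Real.log (heightDensityCan F (γ / lam) hJK S U) + (F.scheme ℰp (γ / lam)).β K * m U)
        - (Real.log (heightDensityCan F (γ / lam) hJK S V) + (F.scheme ℰp (γ / lam)).β K * m V))
      - ((Real.log (heightDensityCan F (γ / lam) hJK S W) + (F.scheme ℰp (γ / lam)).β K * m W)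
        - (Real.log (heightDensityCan F (γ / lam) hJK S Z) + (F.scheme ℰp (γ / lam)).β K * m Z))) atTop
      (𝓝 ((Real.log (C U) - Real.log (C V)) - (Real.log (C W) - Real.log (C Z)))) := by
  have h := ((tendsto_log_add_fluct_of_laplaceLimit F γ hJK S m hU hCU).sub (tendsto_log_add_fluct_of_laplaceLimit F γ hJK S m hV hCV)).sub
    ((tendsto_log_add_fluct_of_laplaceLimit F γ hJK S m hW hCW).sub (tendsto_log_add_fluct_of_laplaceLimit F γ hJK S m hZ hCZ))
  refine h.congr' (Eventually.of_forall fun lam => ?_)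
  ring

end Door

end Summit.QuantumFields.YangMills.Theorems.FluctuationComparisonRegPrIntLS2BetaLaplaceKnit

end
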